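import Summits.AtomisticToContinuum.BoseEinsteinCondensation.Theorems.GaussianDominationCan.Negative.CruxForms

/-!
# Crux `GaussianDominationCan` — the penalty shape: a super-quadratic budget is FALSE

Crux disprover result (gen3) for `stmt-AtomisticToContinuum-9479` (route BECThomsonPrinciple):
`not_gaussianDominationCanSuperquadratic` — the crux with penalty `C s^p L²/‖n‖²` and ANY exponent
`p > 2` (even with `p, C, ρ₀, N₀` chosen after `v, M`) is false already for the free gas `v = 0`.
Witness: the top corner `L = N/4π²` of the window, the coherent two-mode product state
`((α + βe_{e₀})/√L³)^{⊗N}` with `β²L³ = 1/(4N)`, and `s = 3π²/L²`; Bernoulli's inequality.  Read with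
`free_const_ge` (`C ≥ 1/(4π²)` at `p = 2`): the quadratic small-`s` shape AND its constant are pinned by
the free gas.  [folklore]
-/

noncomputable section

namespace Summit.AtomisticToContinuum.BoseEinsteinCondensation.Theorems.GaussianDominationCan.Negative

open MeasureTheory Literature.MathematicalPhysics.QuantumManyBody.BoseGas
open scoped ENNReal NNReal ComplexConjugate

variable {L : ℝ}

/-! ## §B The penalty shape: a super-quadratic budget `C s^p L²/‖n‖²`, `p > 2`, is FALSE -/

section Superquadratic

/-- The crux inequality with a general real power `p` of `s` in the penalty (`s ^ p` is `Real.rpow`). -/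
def GDIneqPow (v : ℝ → ℝ≥0∞) (m : ℕ) (L : ℝ) (n : Fin 3 → ℤ) (C p s : ℝ)
    (Φ : PeriodicTrialState (m + 1) L) : Prop :=
  periodicGroundStateEnergy v (m + 1) L +
      ENNReal.ofReal (s * (2 * (m + 1) * ‖sourceIntegral m L n Φ.ψ‖)) ≤
    periodicEnergy v Φ + ENNReal.ofReal (C * s ^ p * L ^ 2 / ‖(fun j => (n j : ℝ))‖ ^ 2)

/-- At `p = 2` this is the crux inequality verbatim. -/
theorem gdIneqPow_two (v : ℝ → ℝ≥0∞) (m : ℕ) (L : ℝ) (n : Fin 3 → ℤ) (C s : ℝ)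
    (Φ : PeriodicTrialState (m + 1) L) : GDIneqPow v m L n C 2 s Φ ↔ GDIneq v m L n C s Φ := by
  unfold GDIneqPow GDIneq
  rw [Real.rpow_two]

/-- The crux with penalty exponent `p > 2` (the defender may still choose `ρ₀, C, p, N₀` after `v, M`). -/
def GaussianDominationCanSuperquadratic : Prop :=
  ∀ v : ℝ → ℝ≥0∞, IsRepulsiveFiniteRange v → ∀ M : ℝ, 0 < M →
    ∃ ρ₀ C p : ℝ, 0 < ρ₀ ∧ 0 < C ∧ 2 < p ∧ ∃ N₀ : ℕ,
      ∀ m : ℕ, N₀ ≤ m + 1 → ∀ L : ℝ, 0 < L → ((m + 1 : ℕ) : ℝ) ≤ ρ₀ * L ^ 3 →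
        ∀ n : Fin 3 → ℤ, n ≠ 0 → InWindow M m L n → ∀ s : ℝ, 0 ≤ s →
          ∀ Φ : PeriodicTrialState (m + 1) L, GDIneqPow v m L n C p s Φ

/-- Reading a finite-energy `ℝ≥0∞` inequality `E₀ + x ≤ E + y` as the real inequality `x ≤ E + y`
(dropping `E₀ ≥ 0`). -/
theorem real_of_le_budget {E₀ : ℝ≥0∞} {x E y : ℝ} (hE : 0 ≤ E) (hy : 0 ≤ y)
    (h : E₀ + ENNReal.ofReal x ≤ ENNReal.ofReal E + ENNReal.ofReal y) : x ≤ E + y := by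
  rw [← ENNReal.ofReal_add hE hy] at h
  exact (ENNReal.ofReal_le_ofReal_iff (add_nonneg hE hy)).mp (le_add_self.trans h)

/-- Arithmetic of the super-quadratic budget at `s = 3π²/L²`: if `C(3π²)^p ≤ π² L^{2p-4}` then
`C s^p L² ≤ π²/L²`. -/
theorem superquadratic_budget_le {C p L : ℝ} (hL : 0 < L)
    (hmain : C * (3 * Real.pi ^ 2) ^ p ≤ Real.pi ^ 2 * L ^ (2 * p - 4)) :
    C * (3 * Real.pi ^ 2 / L ^ 2) ^ p * L ^ 2 ≤ Real.pi ^ 2 / L ^ 2 := by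
  set q : ℝ := 2 * p - 4 with hqdef
  have hLqpos : 0 < L ^ q := Real.rpow_pos_of_pos hL q
  have hsp : (3 * Real.pi ^ 2 / L ^ 2) ^ p = (3 * Real.pi ^ 2) ^ p / L ^ (2 * p) := by
    rw [Real.div_rpow (by positivity) (by positivity)]
    congr 1
    rw [← Real.rpow_natCast L 2, ← Real.rpow_mul hL.le]
    norm_num
  have hL2p : L ^ (2 * p) = L ^ q * L ^ (4 : ℝ) := by
    rw [← Real.rpow_add hL]
    congr 1
    rw [hqdef]
    ring
  have hL4 : L ^ (4 : ℝ) = L ^ (4 : ℕ) := by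
    rw [show (4 : ℝ) = ((4 : ℕ) : ℝ) by norm_num, Real.rpow_natCast]
  rw [hsp, hL2p, hL4]
  calc C * ((3 * Real.pi ^ 2) ^ p / (L ^ q * L ^ (4 : ℕ))) * L ^ 2
      = (C * (3 * Real.pi ^ 2) ^ p) / (L ^ q * L ^ 2) := by
        field_simp
    _ ≤ (Real.pi ^ 2 * L ^ q) / (L ^ q * L ^ 2) :=
        div_le_div_of_nonneg_right hmain (by positivity)
    _ = Real.pi ^ 2 / L ^ 2 := by
        field_simp

/-- The final contradiction: `2su ≤ 2π²/L²` is impossible for `s = 3π²/L²`, `u² ≥ 1/8`. -/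
theorem superquadratic_contra {u L : ℝ} (hL : 0 < L) (hu : 0 ≤ u) (hu2ge : 1 / 8 ≤ u ^ 2)
    (h3 : 3 * Real.pi ^ 2 / L ^ 2 * (2 * u) ≤ 2 * Real.pi ^ 2 / L ^ 2) : False := by
  set s : ℝ := 3 * Real.pi ^ 2 / L ^ 2 with hsdef
  have hs : 0 ≤ s := by positivity
  have h4 : (s * (2 * u)) ^ 2 ≤ (2 * Real.pi ^ 2 / L ^ 2) ^ 2 :=
    pow_le_pow_left₀ (by positivity) h3 2
  have h5 : (s * (2 * u)) ^ 2 = 4 * s ^ 2 * u ^ 2 := by ring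
  rw [h5] at h4
  have h6 : 4 * s ^ 2 * (1 / 8) ≤ 4 * s ^ 2 * u ^ 2 :=
    mul_le_mul_of_nonneg_left hu2ge (by positivity)
  have h9 := h6.trans h4
  have h7 : s ^ 2 = 9 * Real.pi ^ 4 / L ^ 4 := by
    rw [hsdef]
    field_simp
    ring
  have h8 : (2 * Real.pi ^ 2 / L ^ 2) ^ 2 = 4 * (Real.pi ^ 4 / L ^ 4) := by
    field_simp
    ring
  rw [h7, h8] at h9
  have e9 : 4 * (9 * Real.pi ^ 4 / L ^ 4) * (1 / 8) = 9 / 2 * (Real.pi ^ 4 / L ^ 4) := by ring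
  rw [e9] at h9
  have hX : 0 < Real.pi ^ 4 / L ^ 4 := by positivity
  linarith

/-- **The `s²` shape of the penalty is sharp on the small-`s` side**: with budget `C s^p L²/‖n‖²` and ANY
`p > 2` the statement is false already for the free gas `v = 0` (window `M = 1`).  Witness: the top corner
`L = N/4π²`, `n = e₀`, the coherent two-mode product state `((α + βe_{e₀})/√L³)^{⊗N}` with `β²L³ = 1/(4N)`
(source `u ≥ 1/(2√2)`, energy `π²/L²`), and `s = 3π²/L²`: the needed budget is `≍ s²L² = 9π⁴/L²` while
`C s^p L² = C(3π²)^p L^{2-2p} = o(L⁻²)`.  (So at the corner only `s = O(k²) = O(L⁻²)` matters and the response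
there is genuinely quadratic: finite non-zero susceptibility.) [folklore] -/
theorem not_gaussianDominationCanSuperquadratic : ¬ GaussianDominationCanSuperquadratic := by
  intro h
  obtain ⟨ρ₀, C, p, hρ, hC, hp, N₀, hG⟩ := h 0 isRepulsiveFiniteRange_zero 1 one_pos
  -- exponent bookkeeping: q = 2p - 4 > 0, K = C (3π²)^p / π², Lmin^q = K + 1
  set q : ℝ := 2 * p - 4 with hqdef
  have hq : 0 < q := by rw [hqdef]; linarith
  set K : ℝ := C * (3 * Real.pi ^ 2) ^ p / Real.pi ^ 2 with hKdef
  have hK : 0 < K := by positivity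
  set Lmin : ℝ := (K + 1) ^ q⁻¹ with hLmindef
  have hLmin : 0 ≤ Lmin := by positivity
  -- choice of N (large) and L = N/4π² (top corner, M = 1)
  obtain ⟨m, hmN₀, hmT⟩ :=
    exists_large N₀ (64 * Real.pi ^ 6 / (ρ₀ * 1 ^ 6) + 4 * Real.pi ^ 2 * (1 + Lmin))
  set N : ℝ := ((m + 1 : ℕ) : ℝ) with hNdef
  have hN1 : (1 : ℝ) ≤ N := by rw [hNdef]; exact_mod_cast Nat.succ_le_succ (Nat.zero_le m)
  have hNpos : 0 < N := by linarith
  have hKN : 64 * Real.pi ^ 6 / (ρ₀ * 1 ^ 6) ≤ N := by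
    have : 0 ≤ 4 * Real.pi ^ 2 * (1 + Lmin) := by positivity
    linarith
  obtain ⟨hL, hdens, hwin⟩ := corner one_pos hρ m hKN
  set L : ℝ := 1 ^ 2 * N / (4 * Real.pi ^ 2) with hLdef
  have hL1 : 1 + Lmin ≤ L := by
    rw [hLdef, le_div_iff₀ (by positivity)]
    have e : (1 : ℝ) ^ 2 * N = N := by ring
    have : 0 ≤ 64 * Real.pi ^ 6 / (ρ₀ * 1 ^ 6) := by positivity
    rw [e]
    linarith
  have hLge1 : 1 ≤ L := by linarith
  have hLmin_le : Lmin ≤ L := by linarith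
  have hLq : K + 1 ≤ L ^ q := by
    have h1 : Lmin ^ q = K + 1 := by
      rw [hLmindef, Real.rpow_inv_rpow (by positivity) hq.ne']
    rw [← h1]
    exact Real.rpow_le_rpow hLmin hLmin_le hq.le
  -- amplitudes: B = β²L³ = 1/(4N), A = 1 - B
  set B : ℝ := 1 / (4 * N) with hBdef
  set A : ℝ := 1 - B with hAdef
  have hB : 0 < B := by positivity
  have hB1 : B ≤ 1 / 4 := by
    rw [hBdef, div_le_div_iff₀ (by positivity) (by positivity)]
    nlinarith
  have hA : 0 < A := by rw [hAdef]; linarith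
  set a : ℝ := Real.sqrt (A / L ^ 3) with hadef
  set b : ℝ := Real.sqrt (B / L ^ 3) with hbdef
  have ha : 0 ≤ a := Real.sqrt_nonneg _
  have hb : 0 ≤ b := Real.sqrt_nonneg _
  have ha2 : a ^ 2 * L ^ 3 = A := by
    rw [hadef, Real.sq_sqrt (by positivity), div_mul_cancel₀ _ (by positivity)]
  have hb2 : b ^ 2 * L ^ 3 = B := by
    rw [hbdef, Real.sq_sqrt (by positivity), div_mul_cancel₀ _ (by positivity)]
  have hab : (a ^ 2 + b ^ 2) * L ^ 3 = 1 := by rw [add_mul, ha2, hb2, hAdef]; ring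
  have hN' : (m : ℝ) + 1 = N := by rw [hNdef]; push_cast; ring
  -- the source lower bound u and its square
  have hsrc := norm_sourceIntegral_symFun_ge (m := m) hL e0_ne_zero ha hb
  rw [show L ^ 3 * a ^ 2 = A by rw [← ha2]; ring, hN'] at hsrc
  set P : ℝ := L ^ 3 * a * b with hPdef
  have hP2 : P ^ 2 = A * B := by
    calc P ^ 2 = (a ^ 2 * L ^ 3) * (b ^ 2 * L ^ 3) := by rw [hPdef]; ring
      _ = A * B := by rw [ha2, hb2]
  have hP : 0 ≤ P := by positivity
  set u : ℝ := N * ((Real.sqrt N)⁻¹ * P * A ^ m) with hudef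
  have hu : 0 ≤ u := by positivity
  have hu2 : u ^ 2 = N * (A * B) * A ^ (2 * m) := by
    have h1 : (Real.sqrt N)⁻¹ ^ 2 = N⁻¹ := by rw [inv_pow, Real.sq_sqrt hNpos.le]
    calc u ^ 2 = N ^ 2 * (Real.sqrt N)⁻¹ ^ 2 * P ^ 2 * (A ^ m) ^ 2 := by rw [hudef]; ring
      _ = N ^ 2 * N⁻¹ * (A * B) * A ^ (2 * m) := by rw [h1, hP2, ← pow_mul, mul_comm m 2]
      _ = N * (A * B) * A ^ (2 * m) := by field_simp
  have hNB : N * B = 1 / 4 := by rw [hBdef]; field_simp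
  have hbern : 1 - ((2 * m + 1 : ℕ) : ℝ) * B ≤ A ^ (2 * m + 1) := by
    have hh := one_add_mul_le_pow (show (-2 : ℝ) ≤ -B by linarith) (2 * m + 1)
    have e : (1 : ℝ) + -B = A := by rw [hAdef]; ring
    rw [e] at hh
    linarith [hh]
  have hcast : ((2 * m + 1 : ℕ) : ℝ) = 2 * N - 1 := by rw [hNdef]; push_cast; ring
  have hsmall : ((2 * m + 1 : ℕ) : ℝ) * B ≤ 1 / 2 := by
    rw [hcast, hBdef, mul_one_div, div_le_div_iff₀ (by positivity) (by positivity)]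
    nlinarith [hN1]
  have hA2m1 : 1 / 2 ≤ A ^ (2 * m + 1) := by linarith
  have hu2ge : 1 / 8 ≤ u ^ 2 := by
    rw [hu2]
    calc (1 : ℝ) / 8 = 1 / 4 * (1 / 2) := by norm_num
      _ ≤ (N * B) * A ^ (2 * m + 1) := by
          rw [hNB]; exact mul_le_mul_of_nonneg_left hA2m1 (by norm_num)
      _ = N * (A * B) * A ^ (2 * m) := by ring
  -- apply the hypothesis at s = 3π²/L² to the symmetric product state
  set s : ℝ := 3 * Real.pi ^ 2 / L ^ 2 with hsdef
  have hspos : 0 < s := by positivity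
  have hs : 0 ≤ s := hspos.le
  have key := hG m hmN₀ L hL hdens e0 e0_ne_zero hwin s hs (symState m hL e0_ne_zero a b hab)
  unfold GDIneqPow at key
  have hE := periodicEnergy_symState (m := m) hL e0_ne_zero hab
  rw [nsq_e0, hb2] at hE
  rw [hE, norm_e0, one_pow, div_one] at key
  have hEnn : 0 ≤ N * (B * (4 * Real.pi ^ 2 * 1 / L ^ 2)) := by positivity
  have hpen : 0 ≤ C * s ^ p * L ^ 2 := by positivity
  have hreal : s * (2 * N * ‖sourceIntegral m L e0 (symFun m L e0 a b)‖) ≤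
      N * (B * (4 * Real.pi ^ 2 * 1 / L ^ 2)) + C * s ^ p * L ^ 2 := by
    have h0 := real_of_le_budget hEnn hpen key
    rw [hN'] at h0
    exact h0
  have hI : u ≤ N * ‖sourceIntegral m L e0 (symFun m L e0 a b)‖ := by
    rw [hudef]
    exact mul_le_mul_of_nonneg_left hsrc hNpos.le
  have h2 : s * (2 * u) ≤ N * (B * (4 * Real.pi ^ 2 * 1 / L ^ 2)) + C * s ^ p * L ^ 2 := by
    refine le_trans ?_ hreal
    have : 2 * u ≤ 2 * N * ‖sourceIntegral m L e0 (symFun m L e0 a b)‖ := by linarith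
    exact mul_le_mul_of_nonneg_left this hs
  have e3 : N * (B * (4 * Real.pi ^ 2 * 1 / L ^ 2)) = Real.pi ^ 2 / L ^ 2 := by
    calc N * (B * (4 * Real.pi ^ 2 * 1 / L ^ 2)) = (N * B) * (4 * Real.pi ^ 2 / L ^ 2) := by ring
      _ = Real.pi ^ 2 / L ^ 2 := by rw [hNB]; ring
  rw [e3] at h2
  -- the super-quadratic budget is ≤ π²/L² because L^q ≥ K + 1
  have hmain : C * (3 * Real.pi ^ 2) ^ p ≤ Real.pi ^ 2 * L ^ (2 * p - 4) := by
    have h1 : K ≤ L ^ q := by linarith [hLq]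
    rw [hKdef, div_le_iff₀ (by positivity)] at h1
    rw [← hqdef]
    linarith [h1]
  have hbud : C * s ^ p * L ^ 2 ≤ Real.pi ^ 2 / L ^ 2 := superquadratic_budget_le hL hmain
  -- contradiction: 2su ≤ 2π²/L² but (2su)² ≥ s²/2 = 9π⁴/(2L⁴) > 4π⁴/L⁴
  have h3 : s * (2 * u) ≤ 2 * Real.pi ^ 2 / L ^ 2 := by
    have e : Real.pi ^ 2 / L ^ 2 + Real.pi ^ 2 / L ^ 2 = 2 * Real.pi ^ 2 / L ^ 2 := by ring
    linarith [h2, hbud]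
  exact superquadratic_contra hL hu hu2ge h3

end Superquadratic

end Summit.AtomisticToContinuum.BoseEinsteinCondensation.Theorems.GaussianDominationCan.Negative

end
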